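import Mathlib
import HarnessLib
import Literature.MathematicalPhysics.StatisticalMechanics.WeightDominatingSchedule
import Literature.MathematicalPhysics.StatisticalMechanics.WeightSeedDomination
import Literature.MathematicalPhysics.StatisticalMechanics.TorusFRDModeData
import Literature.MathematicalPhysics.StatisticalMechanics.HigherDerivativeForms

/-!
# The weight data of [ABKM19] Ch. 7 built from a finite-range decomposition, and its domination
# (Theorem 7.1 (w1), (w2), (w7) inputs: `WeightData.Dominated` for the concrete tower)

Assembly of the Chapter-7 files: for the data of [ABKM19] (7.2)–(7.5) —
seed `A_0^X = ½ Σ_{x∈X}|∇φ(x)|² + δ'_0/θ_max · M_0^X` (`1 − 4θ̄ = ½`), step covariances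
`(1+θ̄)𝒞_{k+1}` (as multiplier matrices of the zero-extended coefficients `cExt`), added forms
`δ'_k/θ_max · M_k^X` with `M_k^X = derivForm L k s χ_k^X` — the hypothesis structure
`WeightData.Dominated` of the abstract tower holds with the dominating sequence
`D_k = mulMat (domMul lam θ m t k)`, `m k = derivMul L k s`, `t = tailMul N 𝒞̂`, GIVEN:
the per-mode shell bounds of the decomposition (shape of `TorusFRD` (v)) and its symbol inversion
for the identity coefficient matrix, indicator weights `0 ≤ χ_k^X ≤ θ_max`, and a parameter schedule
as produced by `exists_schedule` (all stated as hypotheses).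

* `frdWeightData` — the data; `symbR_one`, `derivMul_units` (`Σ_i |q^{e_i}|² = |q|²`),
  `norm_qpow_sq_le` (`|q^α|² ≤ (4d)^{|α|−1}|q|²`);
* **`dominated_frdWeightData`**.

Everything is proved; no named fact.

## References
* S. Adams, S. Buchholz, R. Kotecký, S. Müller, arXiv:1910.13564, (7.2)–(7.5), Lemma 7.5, Lemma 7.3
  [AdamsBuchholzKoteckyMuller2019].
-/

noncomputable section

namespace Literature.MathematicalPhysics.StatisticalMechanics.GradientRG

open Finset Real Matrix
open Literature.MathematicalPhysics.StatisticalMechanics.GradientFRD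
  (mulMat qpow qmode qnormSq momNorm symbR InShell ShellBoundsV cExt IsElliptic fourierCoeff
    isSymm_mulMat posSemidef_mulMat_sub mulMat_smul mulMat_add qnormSq_pos qnormSq_bounds
    cExt_nonneg)

variable {d M : ℕ} [NeZero M]

/-- The unit multi-indices `{e_i}`. [cite: AdamsBuchholzKoteckyMuller2019, Ch. 7.1 (7.5)] -/
def unitIndices (d : ℕ) : Finset (Fin d → ℕ) :=
  Finset.univ.image fun i : Fin d => (Pi.single i 1 : Fin d → ℕ)

/-- **The weight data of [ABKM19] (7.5) from a finite-range decomposition** (multiplier form):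
seed `½·derivForm L 0 {e_i} 1_X + (δ'_0/θ_max)·derivForm L 0 s χ_0^X`, `cov k = mulMat((1+θ̄)c_{k+1})`,
`pert k X = (δ'_k/θ_max)·derivForm L k s χ_k^X`, enlargement `enl`.
[cite: AdamsBuchholzKoteckyMuller2019, Ch. 7.1 (7.5)] -/
def frdWeightData (L : ℝ) (N : ℕ) (s : Finset (Fin d → ℕ)) (θbar θmax : ℝ) (δ' : ℕ → ℝ)
    (f : (Fin d → ZMod M) → ℕ → ℂ) (χ : ℕ → Finset (Fin d → ZMod M) → (Fin d → ZMod M) → ℝ)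
    (enl : ℕ → Finset (Fin d → ZMod M) → Finset (Fin d → ZMod M)) : WeightData (Fin d → ZMod M) where
  seed X := (1 / 2 : ℝ) • derivForm L 0 (unitIndices d) (fun x => if x ∈ X then 1 else 0) +
    (δ' 0 / θmax) • derivForm L 0 s (χ 0 X)
  cov k := mulMat (fun κ => (1 + θbar) * cExt N (f κ) (k + 1))
  pert k X := (δ' k / θmax) • derivForm L k s (χ k X)
  enl := enl

/-- `â = |q|²` for the identity coefficient matrix. [cite: Buchholz2016, §2 (2.18)] -/
theorem symbR_one (κ : Fin d → ZMod M) : symbR (1 : Matrix (Fin d) (Fin d) ℝ) κ = qnormSq κ := by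
  unfold symbR qnormSq
  rw [Finset.sum_comm]
  refine sum_congr rfl fun j _ => ?_
  rw [Finset.sum_eq_single j (fun i _ hij => by rw [Matrix.one_apply_ne hij, zero_mul])
    (fun h => (h (mem_univ j)).elim), Matrix.one_apply_eq, one_mul, Complex.sq_norm, Complex.normSq_apply]

/-- `m(unit indices) = |q|²`: `Σ_i |q^{e_i}|² = |q|²` (any `k`). [cite: AdamsBuchholzKoteckyMuller2019, Remark 7.4 (7.32)] -/
theorem derivMul_units (L : ℝ) (k : ℕ) (κ : Fin d → ZMod M) :
    derivMul L k (unitIndices d) κ = qnormSq κ := by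
  classical
  unfold derivMul unitIndices qnormSq
  have hinj : Set.InjOn (fun i : Fin d => (Pi.single i 1 : Fin d → ℕ)) ↑(Finset.univ : Finset (Fin d)) :=
    fun i _ j _ h => by
      by_contra hij
      have := congrFun h i
      simp only [Pi.single_eq_same, Pi.single_apply, if_neg hij] at this
      exact one_ne_zero this
  rw [sum_image hinj]
  refine sum_congr rfl fun i _ => ?_
  rw [norm_qpow_single, Finset.sum_pi_single']
  simp

/-- `|q^α|² ≤ (4d)^{|α|−1} |q|²` for `|α| ≥ 1` (each `|q_i|² ≤ |q|² ≤ 4d`).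
[cite: AdamsBuchholzKoteckyMuller2019, Lemma 7.3 (7.38)] -/
theorem norm_qpow_sq_le {α : Fin d → ℕ} (hα : 1 ≤ ∑ i, α i) (κ : Fin d → ZMod M) :
    ‖qpow α κ‖ ^ 2 ≤ (4 * d) ^ (∑ i, α i - 1) * qnormSq κ := by
  -- `|q^α|² = Π |q_i|^{2α_i} ≤ (|q|²)^{|α|}` and `|q|² ≤ 4d`
  have hqi : ∀ i, ‖qmode κ i‖ ^ 2 ≤ qnormSq κ := fun i =>
    single_le_sum (f := fun j => ‖qmode κ j‖ ^ 2) (fun j _ => sq_nonneg _) (mem_univ i)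
  have hq4 : qnormSq κ ≤ 4 * d := by
    unfold qnormSq
    calc ∑ j, ‖qmode κ j‖ ^ 2 ≤ ∑ _j : Fin d, (4 : ℝ) := sum_le_sum fun j _ => by
          rw [Literature.MathematicalPhysics.StatisticalMechanics.GradientFRD.norm_qmode_sq]
          nlinarith [Real.sin_sq_le_one (Literature.MathematicalPhysics.StatisticalMechanics.GradientFRD.dualMomentum κ j / 2)]
      _ = 4 * d := by rw [sum_const, card_univ, Fintype.card_fin, nsmul_eq_mul]; ring
  have hq0 : 0 ≤ qnormSq κ := by unfold qnormSq; positivity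
  have h1 : ‖qpow α κ‖ ^ 2 ≤ qnormSq κ ^ (∑ i, α i) := by
    unfold qpow
    rw [norm_prod, ← prod_pow, ← Finset.prod_pow_eq_pow_sum]
    refine prod_le_prod (fun i _ => by positivity) fun i _ => ?_
    rw [norm_pow, ← pow_mul, mul_comm, pow_mul]
    exact pow_le_pow_left₀ (sq_nonneg _) (hqi i) _
  calc ‖qpow α κ‖ ^ 2 ≤ qnormSq κ ^ (∑ i, α i) := h1
    _ = qnormSq κ ^ (∑ i, α i - 1) * qnormSq κ := by
        rw [← pow_succ, Nat.sub_add_cancel hα]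
    _ ≤ (4 * d) ^ (∑ i, α i - 1) * qnormSq κ :=
        mul_le_mul_of_nonneg_right (pow_le_pow_left₀ hq0 hq4 _) hq0

/-- `m_0 ≤ K_s |q|²` with `K_s = Σ_{α∈s} (4d)^{|α|−1}`. [cite: AdamsBuchholzKoteckyMuller2019, Lemma 7.3 (7.38)] -/
theorem derivMul_zero_le (L : ℝ) {s : Finset (Fin d → ℕ)} (hs : ∀ α ∈ s, 1 ≤ ∑ i, α i)
    (κ : Fin d → ZMod M) :
    derivMul L 0 s κ ≤ (∑ α ∈ s, ((4 : ℝ) * d) ^ (∑ i, α i - 1)) * qnormSq κ := by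
  unfold derivMul
  rw [sum_mul]
  refine sum_le_sum fun α hα => ?_
  rw [mul_zero, zero_mul, pow_zero, one_mul]
  exact norm_qpow_sq_le (hs α hα) κ

/-- **`WeightData.Dominated` for the weight data of a finite-range decomposition** ([ABKM19] Lemma 7.5
(i),(v) for the data (7.5), via `dominated_of_multipliers`, `seed_le_of_multipliers`,
`h73_of_shellBoundsV`).  Hypotheses: `L ≥ 2` with `3dπ² ≤ 4(L²−4)`, `d ≥ 1`, `1 ≤ d−1+n`, orders of `s`
in `[1, M]` with `e_i, 2e_i ∈ s`, constants `c, C ≥ 0`, per-mode shell data of the coefficients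
`f κ j = 𝒞̂_j(κ)` (shape of `TorusFRD` (v)) with evenness / zero-mode vanishing and the symbol
inversion for `A = 1`, indicator weights `0 ≤ χ_k^X ≤ θ_max`, and a parameter schedule
(`θ (k+1) = θ k − μδ'(k+1)`, `θ̄ ≤ θ k ≤ 1`, `1 + θ̄ > 0`, `0 ≤ δ'`, `δ'(k+1) ≤ (4 lam)⁻¹`,
`μδ'(k+1) ≤ 1 + θ k`, `δ'(k+1) = 0` for `k ≥ N`, `hsmall`, `hlarge`, and the scale-0 condition
`(1/2 + δ'_0 K_s)(1 + θ_0 + lam) ≤ 1`). [cite: AdamsBuchholzKoteckyMuller2019, Lemma 7.5 (v)] -/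
theorem dominated_frdWeightData {L : ℕ} (hL2 : 2 ≤ L) (hd : 1 ≤ d) {n ñ N : ℕ} (hdn : 1 ≤ d - 1 + n)
    {c C : ℝ} (hc : 0 ≤ c) (hC : 0 ≤ C) {f : (Fin d → ZMod M) → ℕ → ℂ}
    (hshell : ∀ κ : Fin d → ZMod M, κ ≠ 0 →
      ∃ j', j' ≤ N ∧ InShell L j' κ ∧ ShellBoundsV d n ñ N j' (L : ℝ) c C (f κ))
    (hf_even : ∀ κ j, cExt N (f (-κ)) j = cExt N (f κ) j) (hf_zero : ∀ j, cExt N (f 0) j = 0)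
    (hinv : ∀ κ : Fin d → ZMod M, κ ≠ 0 →
      (∑ j ∈ Icc 1 (N + 1), cExt N (f κ) j) * symbR (1 : Matrix (Fin d) (Fin d) ℝ) κ = 1)
    {s : Finset (Fin d → ℕ)} (hs : ∀ α ∈ s, 1 ≤ ∑ i, α i)
    (hs1 : ∀ i : Fin d, (Pi.single i 1 : Fin d → ℕ) ∈ s)
    (hs2 : ∀ i : Fin d, (Pi.single i 2 : Fin d → ℕ) ∈ s)
    (hLd : 3 * (d : ℝ) * π ^ 2 ≤ 4 * ((L : ℝ) ^ 2 - 4))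
    {θbar θmax lam μ : ℝ} {θ δ' : ℕ → ℝ} (hθbar : 0 < 1 + θbar) (hθmax : 0 < θmax)
    (hlam : 0 < lam) (hμ0 : 0 ≤ μ)
    (hθrec : ∀ k, θ (k + 1) = θ k - μ * δ' (k + 1)) (hθlo : ∀ k, θbar ≤ θ k) (hθhi : ∀ k, θ k ≤ 1)
    (hδnn : ∀ k, 0 ≤ δ' k) (hδ : ∀ k, δ' (k + 1) ≤ (4 * lam)⁻¹)
    (hμδ : ∀ k, μ * δ' (k + 1) ≤ 1 + θ k) (hδN : ∀ k, N ≤ k → δ' (k + 1) = 0)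
    {k₀ : ℕ}
    (hsmall : ∀ e : ℕ, k₀ + 2 ≤ e →
      4 * (C * (L : ℝ) ^ (2 * (d + ñ) + 1)) * (shellConst s (L : ℝ) e * (d * π ^ 2)) ≤
        lam * ((L : ℝ) ^ (d - 1 + n)) ^ (e + 1))
    (hlarge : ∀ k, shellConst s (L : ℝ) (k₀ + 1) * (d * π ^ 2) *
        ((1 + θ k) * (1 * (4 / π ^ 2))⁻¹ + lam * (4 / π ^ 2)⁻¹) ^ 2 ≤
      μ * ((c / (L : ℝ) ^ (2 * (d + ñ) + 1)) / ((L : ℝ) ^ 2 * ((L : ℝ) ^ (d - 1 + n)) ^ (k₀ + 2))))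
    (hseed0 : (1 / 2 + δ' 0 * ∑ α ∈ s, ((4 : ℝ) * d) ^ (∑ i, α i - 1)) * (1 + θ 0 + lam) ≤ 1)
    {χ : ℕ → Finset (Fin d → ZMod M) → (Fin d → ZMod M) → ℝ} (hχ0 : ∀ k X x, 0 ≤ χ k X x)
    (hχ1 : ∀ k X x, χ k X x ≤ θmax)
    (enl : ℕ → Finset (Fin d → ZMod M) → Finset (Fin d → ZMod M)) :
    (frdWeightData (L : ℝ) N s θbar θmax δ' f χ enl).Dominated
      (fun k => mulMat (domMul lam θ (fun k => derivMul (L : ℝ) k s) (tailMul N f) k)) := by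
  have hLr0 : (0 : ℝ) ≤ (L : ℝ) := by positivity
  have hLr1 : (1 : ℝ) ≤ (L : ℝ) := by exact_mod_cast (show 1 ≤ L by omega)
  have hθpos : ∀ k, 0 ≤ 1 + θ k := fun k => by linarith [hθlo k]
  -- ellipticity of the identity
  have hA : IsElliptic (1 : ℝ) 1 (1 : Matrix (Fin d) (Fin d) ℝ) := by
    refine ⟨Matrix.isSymm_one, fun z => ?_⟩
    have h : ∑ i, ∑ j, z i * (1 : Matrix (Fin d) (Fin d) ℝ) i j * z j = ∑ i, z i ^ 2 := by
      refine sum_congr rfl fun i _ => ?_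
      rw [Finset.sum_eq_single i (fun j _ hji => by rw [Matrix.one_apply_ne (Ne.symm hji)]; ring)
        (fun h => (h (mem_univ i)).elim), Matrix.one_apply_eq]; ring
    rw [h]
    have : 0 ≤ ∑ i, z i ^ 2 := by positivity
    constructor <;> linarith
  -- coefficient facts
  have hc_nonneg : ∀ (j : ℕ) (κ : Fin d → ZMod M), 0 ≤ cExt N (f κ) j := by
    intro j κ
    by_cases hκ : κ = 0
    · rw [hκ, hf_zero]
    · obtain ⟨j', _, _, hv⟩ := hshell κ hκ
      exact cExt_nonneg hv hc hLr0 j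
  -- the multiplier facts
  have hm_pos : ∀ (k : ℕ) (κ : Fin d → ZMod M), κ ≠ 0 → 0 < derivMul (L : ℝ) k s κ :=
    fun k κ hκ => derivMul_pos hLr0 k hs1 hκ
  refine WeightData.dominated_of_multipliers _ (θbar := θbar) (δ' := δ') (c := fun j κ => cExt N (f κ) j)
    hlam hθbar.le hθlo
    (fun k κ => derivMul_neg _ k s κ) hm_pos (fun k => derivMul_zero _ k hs)
    (fun j κ => hf_even κ j) hc_nonneg (fun j => hf_zero j)
    (fun k κ => tailMul_succ N f k κ) (fun k κ => tailMul_nonneg (fun κ j => hc_nonneg j κ) k κ)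
    (fun k κ => ?_) (fun k => ?_) (fun k => rfl)
    (fun X => ?_) (fun X => ?_) (fun X => ?_) (fun k X => ?_) (fun k X => ?_) ?_
  · -- `t k (-κ) = t k κ`
    unfold tailMul; exact sum_congr rfl fun j _ => hf_even κ j
  · -- `t k 0 = 0`
    unfold tailMul; exact sum_eq_zero fun j _ => hf_zero j
  · -- seed symmetric
    exact ((isSymm_derivForm _ _ _ _).smul _).add ((isSymm_derivForm _ _ _ _).smul _)
  · -- seed ⪰ 0
    exact ((posSemidef_derivForm hLr0 0 _ fun x => by positivity).smul (by norm_num)).add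
      ((posSemidef_derivForm hLr0 0 _ (hχ0 0 X)).smul (div_nonneg (hδnn 0) hθmax.le))
  · -- seed ⪯ D_0
    refine seed_le_of_multipliers (ahat := fun κ => symbR (1 : Matrix (Fin d) (Fin d) ℝ) κ)
      (K := ∑ α ∈ s, ((4 : ℝ) * d) ^ (∑ i, α i - 1)) (δ := δ' 0)
      (fun κ hκ => by rw [symbR_one]; exact qnormSq_pos hκ) (by rw [symbR_one]; unfold qnormSq; simp [Literature.MathematicalPhysics.StatisticalMechanics.GradientFRD.qmode_zero])
      (fun κ => by rw [symbR_one]; exact qnormSq_le_derivMul hLr0 0 hs1 κ)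
      (fun κ => by rw [symbR_one]; exact derivMul_zero_le _ hs κ) (derivMul_zero _ 0 hs)
      (fun κ hκ => ?_) (by unfold tailMul; exact sum_eq_zero fun j _ => hf_zero j)
      hlam.le (by linarith [hθlo 0]) (hδnn 0) hseed0 ?_
    · -- `t 0 κ = â⁻¹`
      have h := hinv κ hκ
      have hne : symbR (1 : Matrix (Fin d) (Fin d) ℝ) κ ≠ 0 := by
        rw [symbR_one]; exact (qnormSq_pos hκ).ne'
      unfold tailMul
      rw [show (0 : ℕ) + 1 = 1 from rfl]
      exact (eq_inv_of_mul_eq_one_left h)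
    · -- seed ⪯ mulMat(â/2) + δ'_0 • mulMat(m_0)
      show (mulMat (fun κ => symbR (1 : Matrix (Fin d) (Fin d) ℝ) κ / 2) + δ' 0 • mulMat (derivMul (L : ℝ) 0 s) -
        ((1 / 2 : ℝ) • derivForm (L : ℝ) 0 (unitIndices d) (fun x => if x ∈ X then 1 else 0) +
          (δ' 0 / θmax) • derivForm (L : ℝ) 0 s (χ 0 X))).PosSemidef
      -- gradient part
      have h1 := derivForm_le_smul_mulMat (M := M) hLr0 0 (unitIndices d)
        (χ := fun x => if x ∈ X then (1 : ℝ) else 0) (θ := 1) (fun x => by split_ifs <;> norm_num)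
      have h1' : (mulMat (fun κ => symbR (1 : Matrix (Fin d) (Fin d) ℝ) κ / 2) -
          (1 / 2 : ℝ) • derivForm (L : ℝ) 0 (unitIndices d) (fun x => if x ∈ X then 1 else 0)).PosSemidef := by
        have heq : mulMat (fun κ => symbR (1 : Matrix (Fin d) (Fin d) ℝ) κ / 2) =
            (1 / 2 : ℝ) • ((1 : ℝ) • mulMat (M := M) (fun κ => ∑ α ∈ unitIndices d,
              (L : ℝ) ^ (2 * 0 * (∑ i, α i - 1)) * ‖qpow α κ‖ ^ 2)) := by
          rw [one_smul, ← mulMat_smul]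
          congr 1; funext κ
          have := derivMul_units (M := M) (L : ℝ) 0 κ
          unfold derivMul at this
          rw [this, symbR_one]; ring
        rw [heq, ← smul_sub]
        exact h1.smul (by norm_num)
      -- higher-derivative part
      have h2 := derivForm_le_smul_mulMat (M := M) hLr0 0 s (hχ1 0 X)
      have h2' : (δ' 0 • mulMat (derivMul (L : ℝ) 0 s) - (δ' 0 / θmax) • derivForm (L : ℝ) 0 s (χ 0 X)).PosSemidef := by
        have heq : δ' 0 • mulMat (derivMul (L : ℝ) 0 s) =
            (δ' 0 / θmax) • (θmax • mulMat (M := M) (fun κ => ∑ α ∈ s,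
              (L : ℝ) ^ (2 * 0 * (∑ i, α i - 1)) * ‖qpow α κ‖ ^ 2)) := by
          rw [smul_smul, div_mul_cancel₀ _ hθmax.ne']; rfl
        rw [heq, ← smul_sub]
        exact h2.smul (div_nonneg (hδnn 0) hθmax.le)
      have := h1'.add h2'
      convert this using 1
      abel
  · -- pert ⪰ 0
    exact (posSemidef_derivForm hLr0 k s (hχ0 k X)).smul (div_nonneg (hδnn k) hθmax.le)
  · -- pert ⪯ δ'_k • mulMat m_k
    show (δ' k • mulMat (derivMul (L : ℝ) k s) - (δ' k / θmax) • derivForm (L : ℝ) k s (χ k X)).PosSemidef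
    have h2 := derivForm_le_smul_mulMat (M := M) hLr0 k s (hχ1 k X)
    have heq : δ' k • mulMat (derivMul (L : ℝ) k s) =
        (δ' k / θmax) • (θmax • mulMat (M := M) (fun κ => ∑ α ∈ s,
          (L : ℝ) ^ (2 * k * (∑ i, α i - 1)) * ‖qpow α κ‖ ^ 2)) := by
      rw [smul_smul, div_mul_cancel₀ _ hθmax.ne']; rfl
    rw [heq, ← smul_sub]
    exact h2.smul (div_nonneg (hδnn k) hθmax.le)
  · -- h73
    exact h73_of_shellBoundsV hL2 hd hdn hc hC hshell hA one_pos hinv hs hs1 hs2 hLd hlam hμ0 hθrec hθpos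
      hθhi (fun k => hδnn (k + 1)) hδ hμδ hδN hsmall hlarge

end Literature.MathematicalPhysics.StatisticalMechanics.GradientRG

end
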